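import Mathlib.SetTheory.Cardinal.Finite
import Literature.AnabelianGeometry.SemiGraphs.GraphCoveringFibres
import Literature.AnabelianGeometry.SemiGraphs.ProperBranchLifting

/-!
# A graph-covering of a connected semi-graph with the base's fibre cardinalities has degree one
# ([SemiAnbd] §1 p. 14, §2 p. 23)

Mochizuki, *Semi-graphs of anabelioids*, Publ. RIMS **42** (2006) 221–322, §1 p. 14 (graph-coverings
= proper excisions: bijective on the branches at every vertex, preserving verticial cardinalities) and
§2 p. 23 (the vertices/edges of the finite étale covering attached to `G′ ∈ B(𝒢)` over `v`/`e` ARE the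
connected components of `S_v`/`T_e`) [cite: MochizukiSemiAnbd2006, §1 p.14].

PROOF-ONLY combinatorics (abc-iut cell, layer L3; FACT-LIST row F-1478 `remark_2_4_1_covering` and the
«tie» of the dictionary facts (D2)/(D3): brick **(T-γ)** of `HOME/staging/f/f-161/J1-TIE-ROUTE.md`;
seat abc-iut-f-161).  The DEGREE of a graph-covering `θ : 𝔾′ → 𝔾` is constant on a connected `𝔾`:

* `Hom.natCard_branchFiber_eq_edgeFiber` — for any morphism, the branches over `b` are in bijection
  with the edges over the edge of `b` (morphisms are bijective on the two branches of an edge);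
* `IsGraphCovering.natCard_branchFiber_eq_vertexFiber` — for a graph-covering and `b` abutting to `v`,
  the branches over `b` are in bijection with the vertices over `v` (excision; properness makes the
  branch over an abutting branch abut, `ProperBranchLifting`);
* `IsGraphCovering.natCard_vertexFiber_eq_of_reachable` & co. — hence all fibre cardinalities of a
  graph-covering of a CONNECTED semi-graph agree;
* `IsGraphCovering.bijective_of_natCard_fiber_eq` — **a graph-covering `θ : 𝔾′ → 𝔾` of a connected
  `𝔾`, OVER a base `𝕂` (`θ ≫ π = π′`) with finite fibres over `𝕂` of the SAME cardinalities for `π′`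
  and `π` over every vertex and edge of `𝕂`, is bijective on vertices and on edges** (degree
  `d · #π⁻¹(u) = #π′⁻¹(u) = #π⁻¹(u)` with `#π⁻¹(u) ≥ 1` forces `d = 1`).

Consumer (brick (T-δ)): the canonical labelling `O : ℋ.graph → 𝔾_A` of a four-clause finite étale
covering `ℋ → 𝒦` attached to `A` by the components holding the global base points is a graph-covering
over `𝔾` between semi-graphs with fibres of cardinality `#π₀(A_u)`, `#π₀(A_e)`; hence a bijection.
Pure semi-graph theory: no anabelioids, no `def`, no `Prop` introduced; nothing here takes a side on
[IUTchIII] Cor. 3.12.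
-/

namespace Literature.AnabelianGeometry.SemiGraphs

namespace SemiGraph

open CategoryTheory

universe u

variable {G G' : SemiGraph.{u}} {θ : G' ⟶ G}

/-! ### Fibre cardinalities along incidences -/

/-- **Branches over `b` ↔ edges over the edge of `b`** (any morphism: the two branches of an edge map
bijectively onto the two branches of its image, [SemiAnbd] §1 p. 11).
[cite: MochizukiSemiAnbd2006, §1 p.11] -/
theorem Hom.natCard_branchFiber_eq_edgeFiber (θ : G' ⟶ G) (b : G.Branch) :
    Nat.card {b' : G'.Branch // θ.branchMap b' = b} = Nat.card (θ.EdgeFiber (G.edgeOf b)) := by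
  refine Nat.card_congr
    { toFun := fun b' => ⟨G'.edgeOf b'.1, by rw [← θ.edgeOf_branchMap, b'.2]⟩
      invFun := fun e' => ⟨Hom.branchOver b e', Hom.branchMap_branchOver b e'⟩
      left_inv := fun b' => ?_
      right_inv := fun e' => Subtype.ext (Hom.edgeOf_branchOver b e') }
  apply Subtype.ext
  exact Hom.branch_eq_of_edgeOf_eq_of_branchMap_eq (ψ := θ)
    (Hom.edgeOf_branchOver b ⟨G'.edgeOf b'.1, by rw [← θ.edgeOf_branchMap, b'.2]⟩)
    ((Hom.branchMap_branchOver b _).trans b'.2.symm)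

/-- Over a PROPER morphism, a branch lying over a branch that abuts to `v` abuts to a vertex over `v`
(the bijection of verticial portions, `ProperBranchLifting`). [cite: MochizukiSemiAnbd2006, §1 p.14] -/
theorem IsProper.exists_abuts_of_branchMap_eq (hθ : IsProper θ) {b : G.Branch} {v : G.Vertex}
    (h : G.abuts b = some v) {b' : G'.Branch} (hb' : θ.branchMap b' = b) :
    ∃ v' : G'.Vertex, G'.abuts b' = some v' ∧ θ.vertexMap v' = v := by
  obtain ⟨b'', v', he, hb'', hv', hvv⟩ := exists_branch_preimage_abuts θ hθ (G'.edgeOf b') b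
    (by rw [← hb', θ.edgeOf_branchMap]) v h
  have hbb : b'' = b' := θ.branchMap_injOn _ _ he (hb''.trans hb'.symm)
  subst hbb
  exact ⟨v', hv', hvv⟩

/-- **Branches over `b` ↔ vertices over `v`** for a graph-covering and a branch `b` abutting to `v`:
a branch over `b` abuts (properness) to a vertex over `v`, and a vertex over `v` carries exactly one
branch over `b` (excision). [cite: MochizukiSemiAnbd2006, §1 p.14] -/
theorem IsGraphCovering.natCard_branchFiber_eq_vertexFiber (hθ : IsGraphCovering θ) {b : G.Branch}
    {v : G.Vertex} (h : G.abuts b = some v) :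
    Nat.card {b' : G'.Branch // θ.branchMap b' = b} = Nat.card (θ.VertexFiber v) := by
  classical
  obtain ⟨hp, hx⟩ := hθ
  have hab : ∀ b' : {b' : G'.Branch // θ.branchMap b' = b},
      ∃ v' : G'.Vertex, G'.abuts b'.1 = some v' ∧ θ.vertexMap v' = v :=
    fun b' => hp.exists_abuts_of_branchMap_eq h b'.2
  refine Nat.card_congr
    { toFun := fun b' => ⟨(hab b').choose, (hab b').choose_spec.2⟩
      invFun := fun v' => ⟨(Hom.branchLift hx b v h v').1, Hom.branchMap_branchLift hx b v h v'⟩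
      left_inv := fun b' => ?_
      right_inv := fun v' => ?_ }
  · apply Subtype.ext
    exact (Hom.eq_branchLift hx b v h ⟨(hab b').choose, (hab b').choose_spec.2⟩ b'.1
      (hab b').choose_spec.1 b'.2).symm
  · apply Subtype.ext
    have h1 := (hab ⟨(Hom.branchLift hx b v h v').1, Hom.branchMap_branchLift hx b v h v'⟩).choose_spec.1
    have h2 := Hom.abuts_branchLift hx b v h v'
    exact Option.some_injective _ (h1.symm.trans h2)

/-! ### The degree is constant on a connected base -/

/-- The fibre cardinality of a morphism at a node of the barycentric subdivision (vertex, edge or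
branch). [folklore] -/
private theorem natCard_fiber_node_eq_of_nodeRel (hθ : IsGraphCovering θ) :
    ∀ x y : G.Node, G.NodeRel x y →
      (Sum.elim (fun v => Nat.card (θ.VertexFiber v))
          (Sum.elim (fun e => Nat.card (θ.EdgeFiber e))
            (fun b => Nat.card {b' : G'.Branch // θ.branchMap b' = b})) x : ℕ) =
        Sum.elim (fun v => Nat.card (θ.VertexFiber v))
          (Sum.elim (fun e => Nat.card (θ.EdgeFiber e))
            (fun b => Nat.card {b' : G'.Branch // θ.branchMap b' = b})) y := by
  intro x y hr
  cases hr with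
  | edge_branch b => exact (Hom.natCard_branchFiber_eq_edgeFiber θ b).symm
  | branch_vertex b v h => exact hθ.natCard_branchFiber_eq_vertexFiber h

/-- Along a graph-covering, the fibre cardinality is constant on each connected component of the
barycentric subdivision of the base. [cite: MochizukiSemiAnbd2006, §1 p.14] -/
private theorem natCard_fiber_node_eq_of_reachable (hθ : IsGraphCovering θ) {x y : G.Node}
    (hxy : G.subdivision.Reachable x y) :
    (Sum.elim (fun v => Nat.card (θ.VertexFiber v))
        (Sum.elim (fun e => Nat.card (θ.EdgeFiber e))
          (fun b => Nat.card {b' : G'.Branch // θ.branchMap b' = b})) x : ℕ) =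
      Sum.elim (fun v => Nat.card (θ.VertexFiber v))
        (Sum.elim (fun e => Nat.card (θ.EdgeFiber e))
          (fun b => Nat.card {b' : G'.Branch // θ.branchMap b' = b})) y := by
  obtain ⟨w⟩ := hxy
  induction w with
  | nil => rfl
  | cons hadj _ ih =>
    refine Eq.trans ?_ ih
    rw [subdivision, SimpleGraph.fromRel_adj] at hadj
    rcases hadj.2 with hr | hr
    · exact natCard_fiber_node_eq_of_nodeRel hθ _ _ hr
    · exact (natCard_fiber_node_eq_of_nodeRel hθ _ _ hr).symm

/-- **Constant degree on vertices**: along a graph-covering of a CONNECTED semi-graph, any two vertices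
have fibres of the same cardinality. [cite: MochizukiSemiAnbd2006, §1 p.14] -/
theorem IsGraphCovering.natCard_vertexFiber_eq (hθ : IsGraphCovering θ) (hG : G.IsConnected)
    (v w : G.Vertex) : Nat.card (θ.VertexFiber v) = Nat.card (θ.VertexFiber w) :=
  natCard_fiber_node_eq_of_reachable hθ (hG.connected.preconnected (Sum.inl v) (Sum.inl w))

/-- **Constant degree, vertices vs edges**: along a graph-covering of a CONNECTED semi-graph, the fibre
over any vertex and the fibre over any edge have the same cardinality. [cite: MochizukiSemiAnbd2006, §1 p.14] -/
theorem IsGraphCovering.natCard_vertexFiber_eq_edgeFiber (hθ : IsGraphCovering θ)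
    (hG : G.IsConnected) (v : G.Vertex) (e : G.Edge) :
    Nat.card (θ.VertexFiber v) = Nat.card (θ.EdgeFiber e) :=
  natCard_fiber_node_eq_of_reachable hθ (hG.connected.preconnected (Sum.inl v) (Sum.inr (Sum.inl e)))

/-- **Constant degree on edges**: along a graph-covering of a CONNECTED semi-graph, any two edges have
fibres of the same cardinality. [cite: MochizukiSemiAnbd2006, §1 p.14] -/
theorem IsGraphCovering.natCard_edgeFiber_eq (hθ : IsGraphCovering θ) (hG : G.IsConnected)
    (e f : G.Edge) : Nat.card (θ.EdgeFiber e) = Nat.card (θ.EdgeFiber f) :=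
  natCard_fiber_node_eq_of_reachable hθ
    (hG.connected.preconnected (Sum.inr (Sum.inl e)) (Sum.inr (Sum.inl f)))

/-! ### Degree one from the base's fibre cardinalities -/

/-- Fibres of a composite decompose over the fibres of the second map (vertices). [folklore] -/
private theorem natCard_vertexFiber_comp {K : SemiGraph.{u}} (θ : G' ⟶ G) (π : G ⟶ K) (u : K.Vertex)
    [Fintype (π.VertexFiber u)] [∀ v, Finite (θ.VertexFiber v)] :
    Nat.card ((θ ≫ π).VertexFiber u) = ∑ v : π.VertexFiber u, Nat.card (θ.VertexFiber v.1) := by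
  rw [← Nat.card_sigma]
  exact (Nat.card_congr (Equiv.sigmaSubtypeFiberEquivSubtype θ.vertexMap
    (p := fun v' => π.vertexMap (θ.vertexMap v') = u) (q := fun v => π.vertexMap v = u)
    (fun _ => Iff.rfl))).symm

/-- Fibres of a composite decompose over the fibres of the second map (edges). [folklore] -/
private theorem natCard_edgeFiber_comp {K : SemiGraph.{u}} (θ : G' ⟶ G) (π : G ⟶ K) (u : K.Edge)
    [Fintype (π.EdgeFiber u)] [∀ e, Finite (θ.EdgeFiber e)] :
    Nat.card ((θ ≫ π).EdgeFiber u) = ∑ e : π.EdgeFiber u, Nat.card (θ.EdgeFiber e.1) := by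
  rw [← Nat.card_sigma]
  exact (Nat.card_congr (Equiv.sigmaSubtypeFiberEquivSubtype θ.edgeMap
    (p := fun e' => π.edgeMap (θ.edgeMap e') = u) (q := fun e => π.edgeMap e = u)
    (fun _ => Iff.rfl))).symm

/-- A map all of whose fibres have exactly one element is bijective. [folklore] -/
private theorem bijective_of_natCard_fiber_eq_one {α β : Type u} (f : α → β)
    (h : ∀ b, Nat.card {a : α // f a = b} = 1) : Function.Bijective f := by
  rw [Function.bijective_iff_existsUnique]
  intro b
  obtain ⟨hs, ⟨a⟩⟩ := Nat.card_eq_one_iff_unique.mp (h b)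
  exact ⟨a.1, a.2, fun a' ha' => congrArg Subtype.val (hs.elim ⟨a', ha'⟩ a)⟩

/-- **A graph-covering of a connected semi-graph over a common base, with the base's fibre
cardinalities, is bijective** ([SemiAnbd] §1 p. 14 degree count; §2 p. 23).  Let `θ : 𝔾′ → 𝔾` be a
graph-covering (proper excision) with `𝔾` connected, over a base `𝕂` (`θ ≫ π = π′`), such that over
every vertex and every edge of `𝕂` the fibres of `π′` and of `π` are finite of the same cardinality.
Then `θ` is bijective on vertices and on edges: its degree `d` is constant (`𝔾` connected) and
`d · #π⁻¹(u) = #π′⁻¹(u) = #π⁻¹(u)` at a vertex (or edge) `u` under a vertex (or edge) of `𝔾` forces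
`d = 1`. [cite: MochizukiSemiAnbd2006, §1 p.14] -/
theorem IsGraphCovering.bijective_of_natCard_fiber_eq {K : SemiGraph.{u}} (hθ : IsGraphCovering θ)
    (hG : G.IsConnected) {π : G ⟶ K} {π' : G' ⟶ K} (hcomm : θ ≫ π = π')
    [∀ u, Finite (π.VertexFiber u)] [∀ u, Finite (π'.VertexFiber u)]
    [∀ e, Finite (π.EdgeFiber e)] [∀ e, Finite (π'.EdgeFiber e)]
    (hV : ∀ u, Nat.card (π'.VertexFiber u) = Nat.card (π.VertexFiber u))
    (hE : ∀ e, Nat.card (π'.EdgeFiber e) = Nat.card (π.EdgeFiber e)) :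
    Function.Bijective θ.vertexMap ∧ Function.Bijective θ.edgeMap := by
  classical
  subst hcomm
  -- the fibres of `θ` are finite: they embed into the fibres of `θ ≫ π`
  haveI hfinV : ∀ v, Finite (θ.VertexFiber v) := fun v =>
    Finite.of_injective (fun v' : θ.VertexFiber v =>
      (⟨v'.1, by change π.vertexMap (θ.vertexMap v'.1) = π.vertexMap v; rw [v'.2]⟩ :
        (θ ≫ π).VertexFiber (π.vertexMap v)))
      (fun a b hab => Subtype.ext (congrArg (fun x => x.1) hab))
  haveI hfinE : ∀ e, Finite (θ.EdgeFiber e) := fun e =>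
    Finite.of_injective (fun e' : θ.EdgeFiber e =>
      (⟨e'.1, by change π.edgeMap (θ.edgeMap e'.1) = π.edgeMap e; rw [e'.2]⟩ :
        (θ ≫ π).EdgeFiber (π.edgeMap e)))
      (fun a b hab => Subtype.ext (congrArg (fun x => x.1) hab))
  -- the degree is `1` at some node, hence everywhere
  have key : (∀ v, Nat.card (θ.VertexFiber v) = 1) ∧ ∀ e, Nat.card (θ.EdgeFiber e) = 1 := by
    obtain ⟨x⟩ := hG.connected.nonempty
    -- a vertex or an edge of `G`
    have hve : Nonempty G.Vertex ∨ Nonempty G.Edge := by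
      rcases x with v | e | b
      · exact Or.inl ⟨v⟩
      · exact Or.inr ⟨e⟩
      · exact Or.inr ⟨G.edgeOf b⟩
    rcases hve with hv₀ | he₀
    · -- count over the vertex `π v₀` of the base
      obtain ⟨v₀⟩ := hv₀
      have hd : Nat.card (θ.VertexFiber v₀) = 1 := by
        letI : Fintype (π.VertexFiber (π.vertexMap v₀)) := Fintype.ofFinite _
        have hsum := natCard_vertexFiber_comp θ π (π.vertexMap v₀)
        rw [Finset.sum_congr rfl (fun v _ => hθ.natCard_vertexFiber_eq hG v.1 v₀), Finset.sum_const,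
          Finset.card_univ, smul_eq_mul, hV, Nat.card_eq_fintype_card] at hsum
        have hpos : 0 < Fintype.card (π.VertexFiber (π.vertexMap v₀)) :=
          Fintype.card_pos_iff.mpr ⟨⟨v₀, rfl⟩⟩
        have h2 : Fintype.card (π.VertexFiber (π.vertexMap v₀)) * Nat.card (θ.VertexFiber v₀) =
            Fintype.card (π.VertexFiber (π.vertexMap v₀)) * 1 := by rw [Nat.mul_one]; exact hsum.symm
        exact Nat.eq_of_mul_eq_mul_left hpos h2
      exact ⟨fun v => (hθ.natCard_vertexFiber_eq hG v v₀).trans hd,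
        fun e => (hθ.natCard_vertexFiber_eq_edgeFiber hG v₀ e).symm.trans hd⟩
    · -- count over the edge `π e₀` of the base
      obtain ⟨e₀⟩ := he₀
      have hd : Nat.card (θ.EdgeFiber e₀) = 1 := by
        letI : Fintype (π.EdgeFiber (π.edgeMap e₀)) := Fintype.ofFinite _
        have hsum := natCard_edgeFiber_comp θ π (π.edgeMap e₀)
        rw [Finset.sum_congr rfl (fun e _ => hθ.natCard_edgeFiber_eq hG e.1 e₀), Finset.sum_const,
          Finset.card_univ, smul_eq_mul, hE, Nat.card_eq_fintype_card] at hsum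
        have hpos : 0 < Fintype.card (π.EdgeFiber (π.edgeMap e₀)) :=
          Fintype.card_pos_iff.mpr ⟨⟨e₀, rfl⟩⟩
        have h2 : Fintype.card (π.EdgeFiber (π.edgeMap e₀)) * Nat.card (θ.EdgeFiber e₀) =
            Fintype.card (π.EdgeFiber (π.edgeMap e₀)) * 1 := by rw [Nat.mul_one]; exact hsum.symm
        exact Nat.eq_of_mul_eq_mul_left hpos h2
      have hv : ∀ v, Nat.card (θ.VertexFiber v) = 1 := fun v =>
        (hθ.natCard_vertexFiber_eq_edgeFiber hG v e₀).trans hd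
      exact ⟨hv, fun e => (hθ.natCard_edgeFiber_eq hG e e₀).trans hd⟩
  exact ⟨bijective_of_natCard_fiber_eq_one θ.vertexMap key.1,
    bijective_of_natCard_fiber_eq_one θ.edgeMap key.2⟩

end SemiGraph

end Literature.AnabelianGeometry.SemiGraphs
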